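import Mathlib
import HarnessLib
import Summits.ValiantsHypothesis.ValiantsHypothesis.Theses.MonotoneRestoration
import Literature.Computability.AlgebraicComplexity.ArithCircuit
import Literature.Computability.AlgebraicComplexity.ArithCircuitProofs
import Literature.Computability.AlgebraicComplexity.MonotoneStructure
import Literature.Computability.AlgebraicComplexity.PermanentIrreducible
import Literature.ModelTheory.FiniteModelTheory.CkEquiv
import Summits.ValiantsHypothesis.ValiantsHypothesis.Theorems.MonotoneRestorationMonotoneRestorationQPCosetCount
import Summits.ValiantsHypothesis.ValiantsHypothesis.Theorems.MonotoneRestorationMonotoneRestorationQPSymmetricLB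
import Summits.ValiantsHypothesis.ValiantsHypothesis.Theorems.MonotoneRestorationMonotoneRestorationQPSupportSymmetrisation
import Summits.ValiantsHypothesis.ValiantsHypothesis.Theorems.MonotoneRestorationMonotoneRestorationQPSparseRegime
import Summits.ValiantsHypothesis.ValiantsHypothesis.Theorems.MonotoneRestorationMonotoneRestorationQPBeta
import Literature.Computability.AlgebraicComplexity.SymmetricArithCircuit
import Literature.Computability.AlgebraicComplexity.DawarWilsenach2025Proofs
import Literature.GroupTheory.PermutationGroups.SmallIndexSubgroups
import Summits.ValiantsHypothesis.ValiantsHypothesis.Theorems.MonotoneRestorationQP.Negative.LoadBearing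
import Summits.ValiantsHypothesis.ValiantsHypothesis.Theorems.MonotoneRestorationMonotoneRestorationQPPermSupportCount

/-! TTRL-lite variant V14619 of stmt-ValiantsHypothesis-15886

Variant `bound_nat:d≤3` of stub `stub_symmetricMonotone_choose_le_card` (line c2 of crux
`MonotoneRestorationQP`). The added hypothesis `d ≤ 3` is incompatible with `2 ≤ k` and
`k * k ≤ d` (which force `4 ≤ d`), so the variant holds vacuously.
-/

-- `Summit.ValiantsHypothesis.ValiantsHypothesis.…` is the tree's mandated single-conjunct layout
-- (Sub = Summit), so the duplicated namespace component is intended.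
set_option linter.dupNamespace false

namespace Summit.ValiantsHypothesis.ValiantsHypothesis.Theorems

open Summit.ValiantsHypothesis.ValiantsHypothesis.Theses.MonotoneRestoration
open Literature.Computability.AlgebraicComplexity

/-- TTRL-lite variant V14619 (move `small_case`, op `bound_nat:d≤3`) of
`stub_symmetricMonotone_choose_le_card` (stmt-ValiantsHypothesis-15886): under the extra
hypothesis `d ≤ 3` the statement is vacuous, since `2 ≤ k` and `k * k ≤ d` force `4 ≤ d`. -/
theorem stub_symmetricMonotone_choose_le_card_var14619 :
    ∀ (n : ℕ) (G : Type) [Fintype G] (C : LabelledArithCircuit NNReal (Fin n × Fin n) Unit G)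
      (hC : C.IsSymmetric (Equiv.Perm (Fin n))) (d k : ℕ)
      (hhom : (C.eval (C.output ())).IsHomogeneous d) (h0 : C.eval (C.output ()) ≠ 0)
      (hrow : ∀ m ∈ (C.eval (C.output ())).support, ∀ i : Fin n, rowDegrees m i ≤ 1)
      (hn : 8 < n) (hk : 2 ≤ k) (h4k : 4 * k ≤ n) (hkd : k * k ≤ d) (hdk : d + k + 9 ≤ n),
      d ≤ 3 → n.choose k ≤ Fintype.card G := by
  intro n G _ C _ d k _ _ _ _ hk _ hkd _ hd3
  exfalso
  have h4 : 2 * 2 ≤ k * k := Nat.mul_le_mul hk hk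
  omega

end Summit.ValiantsHypothesis.ValiantsHypothesis.Theorems
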